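import Literature.Analysis.FunctionSpaces.BesselMomentsKernel
import Mathlib.MeasureTheory.Integral.IntegralEqImproper
import HarnessLib

/-!
# Bounds for the rotated Schläfli kernel: `∫ m_ρ ≤ √3 Γ(η) ρ^{-η} + 4e^{-ρ}`, `‖P(z)‖ = O(|z|^{-1/2})`

Theorem-only sibling of `BesselMomentsKernel.lean` (second file towards
`Zhou2017_B3G_sumRule_holds`; see the module docstring there for the whole plan). For the
majorant `m_ρ(w) = e^{-w} w^{-1/2} |w - 2ρ|^{-1/2}` of the integrand of `P(z)` on `‖z‖ = ρ`:

* off the window `(ρ, 3ρ)`, `m_ρ(w) ≤ √3 ρ^{-η} e^{-w} w^{η-1}` (`0 < η ≤ 1/2`), on it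
  `m_ρ(w) ≤ e^{-ρ} ρ^{-1/2} |w - 2ρ|^{-1/2}` and `∫_ρ^{3ρ} |w - 2ρ|^{-1/2} dw = 4ρ^{1/2}`;
* hence `m_ρ ∈ L¹(0,∞)` and `∫₀^∞ m_ρ ≤ √3 Γ(η) ρ^{-η} + 4 e^{-ρ}`
  (`integrableOn_zhouMajorant_and_integral_le`), the integrand of `P(z)` is integrable for
  `z ≠ 0`, and `‖P(z)‖ ≤ √3 Γ(η) ‖z‖^{-η} + 4e^{-‖z‖}`: the decay `‖P(z)‖ ≤ (√3√π + 4)‖z‖^{-1/2}`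
  (`η = 1/2`) and the logarithmic regime `‖P(z)‖ ≤ (√3Γ(η) + 4)‖z‖^{-η}` for `‖z‖ ≤ 1`.

## References

* [Zhou2017] Y. Zhou, Hilbert transforms and sum rules of Bessel moments, arXiv:1706.01068, §2–3.
-/

noncomputable section

open MeasureTheory Set Filter
open scoped Topology ComplexConjugate

namespace Literature.Analysis.FunctionSpaces

/-! ### Bounds for the majorant -/

/-- Off the window `(ρ, 3ρ)`: `m_ρ(w) ≤ √3 ρ^{-η} e^{-w} w^{η-1}` (`0 < η ≤ 1/2`). [folklore] -/
theorem zhouMajorant_le_off {ρ η w : ℝ} (hρ : 0 < ρ) (hη : 0 < η) (hη' : η ≤ 1 / 2) (hw : 0 < w)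
    (hw' : w ∉ Ioo ρ (3 * ρ)) :
    zhouMajorant ρ w ≤ Real.sqrt 3 * ρ ^ (-η) * (Real.exp (-w) * w ^ (η - 1)) := by
  have hexp : 0 < Real.exp (-w) := Real.exp_pos _
  have h3 : (1 : ℝ) ≤ Real.sqrt 3 := by
    rw [show (1 : ℝ) = Real.sqrt 1 by simp]
    exact Real.sqrt_le_sqrt (by norm_num)
  rcases le_or_gt w ρ with h | h
  · -- `w ≤ ρ`: `|w - 2ρ| ≥ ρ`
    have habs : ρ ≤ |w - 2 * ρ| := by
      rw [abs_of_nonpos (by linarith)]; linarith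
    have h1 : |w - 2 * ρ| ^ (-(1 / 2) : ℝ) ≤ ρ ^ (-(1 / 2) : ℝ) :=
      Real.rpow_le_rpow_of_nonpos hρ habs (by norm_num)
    have h2 : w ^ (-(1 / 2) : ℝ) * ρ ^ (-(1 / 2) : ℝ) ≤ w ^ (η - 1) * ρ ^ (-η) := by
      have e : w ^ (η - 1) * ρ ^ (-η) =
          w ^ (-(1 / 2) : ℝ) * ρ ^ (-(1 / 2) : ℝ) * (ρ ^ (1 / 2 - η) / w ^ (1 / 2 - η)) := by
        rw [show η - 1 = -(1 / 2) - (1 / 2 - η) by ring, Real.rpow_sub hw,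
          show -η = -(1 / 2) + (1 / 2 - η) by ring, Real.rpow_add hρ]
        ring
      rw [e, ← Real.div_rpow hρ.le hw.le]
      have : 1 ≤ (ρ / w) ^ (1 / 2 - η) :=
        Real.one_le_rpow ((one_le_div hw).2 h) (by linarith)
      calc w ^ (-(1 / 2) : ℝ) * ρ ^ (-(1 / 2) : ℝ)
          = w ^ (-(1 / 2) : ℝ) * ρ ^ (-(1 / 2) : ℝ) * 1 := (mul_one _).symm
        _ ≤ w ^ (-(1 / 2) : ℝ) * ρ ^ (-(1 / 2) : ℝ) * (ρ / w) ^ (1 / 2 - η) :=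
          mul_le_mul_of_nonneg_left this (by positivity)
    calc zhouMajorant ρ w
        = Real.exp (-w) * (w ^ (-(1 / 2) : ℝ) * |w - 2 * ρ| ^ (-(1 / 2) : ℝ)) := by
          rw [zhouMajorant, zhouWeight]; ring
      _ ≤ Real.exp (-w) * (w ^ (-(1 / 2) : ℝ) * ρ ^ (-(1 / 2) : ℝ)) :=
          mul_le_mul_of_nonneg_left (mul_le_mul_of_nonneg_left h1 (by positivity)) hexp.le
      _ ≤ Real.exp (-w) * (w ^ (η - 1) * ρ ^ (-η)) := mul_le_mul_of_nonneg_left h2 hexp.le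
      _ = 1 * ρ ^ (-η) * (Real.exp (-w) * w ^ (η - 1)) := by ring
      _ ≤ Real.sqrt 3 * ρ ^ (-η) * (Real.exp (-w) * w ^ (η - 1)) := by
          gcongr
  · -- `w ≥ 3ρ`: `|w - 2ρ| ≥ w / 3`
    have hw3 : 3 * ρ ≤ w := by
      by_contra h'
      exact hw' ⟨h, not_le.1 h'⟩
    have habs : w / 3 ≤ |w - 2 * ρ| := by
      rw [abs_of_nonneg (by linarith)]; linarith
    have h1 : |w - 2 * ρ| ^ (-(1 / 2) : ℝ) ≤ (w / 3) ^ (-(1 / 2) : ℝ) :=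
      Real.rpow_le_rpow_of_nonpos (by positivity) habs (by norm_num)
    have h1' : (w / 3) ^ (-(1 / 2) : ℝ) = Real.sqrt 3 * w ^ (-(1 / 2) : ℝ) := by
      rw [Real.div_rpow hw.le (by norm_num), Real.sqrt_eq_rpow, div_eq_mul_inv,
        ← Real.rpow_neg (by norm_num : (0 : ℝ) ≤ 3), neg_neg, mul_comm]
    have h2 : w ^ (-(1 / 2) : ℝ) * w ^ (-(1 / 2) : ℝ) ≤ w ^ (η - 1) * ρ ^ (-η) := by
      have e : w ^ (η - 1) * ρ ^ (-η) =
          w ^ (-(1 / 2) : ℝ) * w ^ (-(1 / 2) : ℝ) * (w ^ η / ρ ^ η) := by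
        rw [← Real.rpow_add hw, show η - 1 = -(1 / 2) + -(1 / 2) + η by ring, Real.rpow_add hw,
          Real.rpow_neg hρ.le]
        ring
      rw [e, ← Real.div_rpow hw.le hρ.le]
      have : 1 ≤ (w / ρ) ^ η :=
        Real.one_le_rpow ((one_le_div hρ).2 (by linarith)) hη.le
      calc w ^ (-(1 / 2) : ℝ) * w ^ (-(1 / 2) : ℝ)
          = w ^ (-(1 / 2) : ℝ) * w ^ (-(1 / 2) : ℝ) * 1 := (mul_one _).symm
        _ ≤ w ^ (-(1 / 2) : ℝ) * w ^ (-(1 / 2) : ℝ) * (w / ρ) ^ η :=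
          mul_le_mul_of_nonneg_left this (by positivity)
    calc zhouMajorant ρ w
        = Real.exp (-w) * (w ^ (-(1 / 2) : ℝ) * |w - 2 * ρ| ^ (-(1 / 2) : ℝ)) := by
          rw [zhouMajorant, zhouWeight]; ring
      _ ≤ Real.exp (-w) * (w ^ (-(1 / 2) : ℝ) * (Real.sqrt 3 * w ^ (-(1 / 2) : ℝ))) := by
          rw [← h1']
          exact mul_le_mul_of_nonneg_left (mul_le_mul_of_nonneg_left h1 (by positivity)) hexp.le
      _ = Real.sqrt 3 * (Real.exp (-w) * (w ^ (-(1 / 2) : ℝ) * w ^ (-(1 / 2) : ℝ))) := by ring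
      _ ≤ Real.sqrt 3 * (Real.exp (-w) * (w ^ (η - 1) * ρ ^ (-η))) :=
          mul_le_mul_of_nonneg_left (mul_le_mul_of_nonneg_left h2 hexp.le) (by positivity)
      _ = Real.sqrt 3 * ρ ^ (-η) * (Real.exp (-w) * w ^ (η - 1)) := by ring

/-- On the window `(ρ, 3ρ)`: `m_ρ(w) ≤ e^{-ρ} ρ^{-1/2} |w - 2ρ|^{-1/2}`. [folklore] -/
theorem zhouMajorant_le_on {ρ w : ℝ} (hρ : 0 < ρ) (hw : w ∈ Ioo ρ (3 * ρ)) :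
    zhouMajorant ρ w ≤ Real.exp (-ρ) * ρ ^ (-(1 / 2) : ℝ) * |w - 2 * ρ| ^ (-(1 / 2) : ℝ) := by
  rw [zhouMajorant, zhouWeight]
  have hw0 : 0 < w := hρ.trans hw.1
  refine mul_le_mul_of_nonneg_right ?_ (Real.rpow_nonneg (abs_nonneg _) _)
  exact mul_le_mul (Real.exp_le_exp.2 (by linarith [hw.1]))
    (Real.rpow_le_rpow_of_nonpos hρ hw.1.le (by norm_num)) (Real.rpow_nonneg hw0.le _)
    (Real.exp_pos _).le

/-- `∫_ρ^{3ρ} |w - 2ρ|^{-1/2} dw = 4 ρ^{1/2}`, with interval integrability. [folklore] -/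
theorem intervalIntegrable_abs_sub_rpow {ρ : ℝ} (hρ : 0 < ρ) :
    IntervalIntegrable (fun w : ℝ => |w - 2 * ρ| ^ (-(1 / 2) : ℝ)) volume ρ (2 * ρ) ∧
    IntervalIntegrable (fun w : ℝ => |w - 2 * ρ| ^ (-(1 / 2) : ℝ)) volume (2 * ρ) (3 * ρ) ∧
    ∫ w in ρ..3 * ρ, |w - 2 * ρ| ^ (-(1 / 2) : ℝ) = 4 * ρ ^ (1 / 2 : ℝ) := by
  have hr : (-1 : ℝ) < -(1 / 2) := by norm_num
  have base : IntervalIntegrable (fun x : ℝ => x ^ (-(1 / 2) : ℝ)) volume 0 ρ :=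
    intervalIntegral.intervalIntegrable_rpow' hr
  -- left half `[ρ, 2ρ]`: `|w - 2ρ| = 2ρ - w`
  have hL0 : IntervalIntegrable (fun w : ℝ => (2 * ρ - w) ^ (-(1 / 2) : ℝ)) volume ρ (2 * ρ) := by
    have h : IntervalIntegrable (fun w : ℝ => (2 * ρ - w) ^ (-(1 / 2) : ℝ)) volume (2 * ρ - 0)
        (2 * ρ - ρ) := base.comp_sub_left (2 * ρ)
    rw [sub_zero, show 2 * ρ - ρ = ρ by ring] at h
    exact h.symm
  have hL : IntervalIntegrable (fun w : ℝ => |w - 2 * ρ| ^ (-(1 / 2) : ℝ)) volume ρ (2 * ρ) := by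
    refine hL0.congr fun w hw => ?_
    rw [uIoc_of_le (by linarith)] at hw
    show (2 * ρ - w) ^ (-(1 / 2) : ℝ) = |w - 2 * ρ| ^ (-(1 / 2) : ℝ)
    rw [abs_of_nonpos (by linarith [hw.2]), neg_sub]
  -- right half `[2ρ, 3ρ]`: `|w - 2ρ| = w - 2ρ`
  have hR0 : IntervalIntegrable (fun w : ℝ => (w - 2 * ρ) ^ (-(1 / 2) : ℝ)) volume (2 * ρ) (3 * ρ) := by
    have h : IntervalIntegrable (fun w : ℝ => (w - 2 * ρ) ^ (-(1 / 2) : ℝ)) volume (0 + 2 * ρ)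
        (ρ + 2 * ρ) := base.comp_sub_right (2 * ρ)
    rw [zero_add, show ρ + 2 * ρ = 3 * ρ by ring] at h
    exact h
  have hR : IntervalIntegrable (fun w : ℝ => |w - 2 * ρ| ^ (-(1 / 2) : ℝ)) volume (2 * ρ) (3 * ρ) := by
    refine hR0.congr fun w hw => ?_
    rw [uIoc_of_le (by linarith)] at hw
    show (w - 2 * ρ) ^ (-(1 / 2) : ℝ) = |w - 2 * ρ| ^ (-(1 / 2) : ℝ)
    rw [abs_of_nonneg (by linarith [hw.1])]
  refine ⟨hL, hR, ?_⟩
  rw [← intervalIntegral.integral_add_adjacent_intervals hL hR]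
  have vL : ∫ w in ρ..2 * ρ, |w - 2 * ρ| ^ (-(1 / 2) : ℝ) = 2 * ρ ^ (1 / 2 : ℝ) := by
    rw [intervalIntegral.integral_congr (g := fun w : ℝ => (2 * ρ - w) ^ (-(1 / 2) : ℝ))]
    · rw [intervalIntegral.integral_comp_sub_left (fun x : ℝ => x ^ (-(1 / 2) : ℝ)) (2 * ρ)]
      rw [show 2 * ρ - 2 * ρ = 0 by ring, show 2 * ρ - ρ = ρ by ring, integral_rpow (Or.inl hr)]
      rw [Real.zero_rpow (by norm_num)]
      norm_num
      ring
    · intro w hw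
      rw [uIcc_of_le (by linarith)] at hw
      show |w - 2 * ρ| ^ (-(1 / 2) : ℝ) = (2 * ρ - w) ^ (-(1 / 2) : ℝ)
      rw [abs_of_nonpos (by linarith [hw.2]), neg_sub]
  have vR : ∫ w in 2 * ρ..3 * ρ, |w - 2 * ρ| ^ (-(1 / 2) : ℝ) = 2 * ρ ^ (1 / 2 : ℝ) := by
    rw [intervalIntegral.integral_congr (g := fun w : ℝ => (w - 2 * ρ) ^ (-(1 / 2) : ℝ))]
    · rw [intervalIntegral.integral_comp_sub_right (fun x : ℝ => x ^ (-(1 / 2) : ℝ)) (2 * ρ)]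
      rw [show 2 * ρ - 2 * ρ = 0 by ring, show 3 * ρ - 2 * ρ = ρ by ring, integral_rpow (Or.inl hr)]
      rw [Real.zero_rpow (by norm_num)]
      norm_num
      ring
    · intro w hw
      rw [uIcc_of_le (by linarith)] at hw
      show |w - 2 * ρ| ^ (-(1 / 2) : ℝ) = (w - 2 * ρ) ^ (-(1 / 2) : ℝ)
      rw [abs_of_nonneg (by linarith [hw.1])]
  rw [vL, vR]
  ring

/-- **The majorant is integrable on `(0,∞)` and `∫₀^∞ m_ρ ≤ √3 Γ(η) ρ^{-η} + 4e^{-ρ}`**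
(`ρ > 0`, `0 < η ≤ 1/2`): off the window `(ρ,3ρ)` compare with the `Γ(η)` integrand, on it
integrate `|w-2ρ|^{-1/2}` exactly. [folklore] -/
theorem integrableOn_zhouMajorant_and_integral_le {ρ η : ℝ} (hρ : 0 < ρ) (hη : 0 < η)
    (hη' : η ≤ 1 / 2) :
    IntegrableOn (zhouMajorant ρ) (Ioi 0) ∧
    ∫ w in Ioi 0, zhouMajorant ρ w ≤
      Real.sqrt 3 * Real.Gamma η * ρ ^ (-η) + 4 * Real.exp (-ρ) := by
  set B : Set ℝ := Ioo ρ (3 * ρ) with hB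
  set A : Set ℝ := Ioi 0 \ B with hA
  have hBsub : B ⊆ Ioi 0 := fun w hw => hρ.trans hw.1
  have hAB : Ioi 0 = A ∪ B := (sdiff_union_of_subset hBsub).symm
  have hdisj : Disjoint A B := disjoint_sdiff_left
  have hBm : MeasurableSet B := measurableSet_Ioo
  have hAm : MeasurableSet A := measurableSet_Ioi.diff hBm
  -- the comparison function off the window
  set g₁ : ℝ → ℝ := fun w => Real.sqrt 3 * ρ ^ (-η) * (Real.exp (-w) * w ^ (η - 1)) with hg₁
  have hg₁_int : IntegrableOn g₁ (Ioi 0) := (integrableOn_exp_neg_mul_rpow hη).const_mul _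
  have hg₁_val : ∫ w in Ioi 0, g₁ w = Real.sqrt 3 * Real.Gamma η * ρ ^ (-η) := by
    simp only [hg₁]
    rw [integral_const_mul, ← Real.Gamma_eq_integral hη]
    ring
  -- the comparison function on the window
  set g₂ : ℝ → ℝ := fun w => Real.exp (-ρ) * ρ ^ (-(1 / 2) : ℝ) * |w - 2 * ρ| ^ (-(1 / 2) : ℝ)
    with hg₂
  obtain ⟨hL, hR, hval⟩ := intervalIntegrable_abs_sub_rpow hρ
  have hLR : IntervalIntegrable (fun w : ℝ => |w - 2 * ρ| ^ (-(1 / 2) : ℝ)) volume ρ (3 * ρ) :=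
    hL.trans hR
  have hf_int : IntegrableOn (fun w : ℝ => |w - 2 * ρ| ^ (-(1 / 2) : ℝ)) B := by
    exact hLR.1.mono_set Ioo_subset_Ioc_self
  have hg₂_int : IntegrableOn g₂ B := hf_int.const_mul _
  have hg₂_val : ∫ w in B, g₂ w = 4 * Real.exp (-ρ) := by
    have h1 : ∫ w in B, |w - 2 * ρ| ^ (-(1 / 2) : ℝ) = 4 * ρ ^ (1 / 2 : ℝ) := by
      rw [hB, ← integral_Ioc_eq_integral_Ioo, ← intervalIntegral.integral_of_le (by linarith), hval]
    simp only [hg₂]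
    rw [integral_const_mul, h1, Real.rpow_neg hρ.le]
    have : ρ ^ (1 / 2 : ℝ) ≠ 0 := (Real.rpow_pos_of_pos hρ _).ne'
    field_simp
  -- integrability of the majorant on both pieces
  have hmeas : AEStronglyMeasurable (zhouMajorant ρ) volume :=
    (measurable_zhouMajorant ρ).aestronglyMeasurable
  have hintA : IntegrableOn (zhouMajorant ρ) A := by
    refine Integrable.mono' (hg₁_int.mono_set sdiff_subset) hmeas.restrict ?_
    refine ae_restrict_of_forall_mem hAm fun w hw => ?_
    rw [Real.norm_of_nonneg (zhouMajorant_nonneg ρ (le_of_lt hw.1))]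
    exact zhouMajorant_le_off hρ hη hη' hw.1 hw.2
  have hintB : IntegrableOn (zhouMajorant ρ) B := by
    refine Integrable.mono' hg₂_int hmeas.restrict ?_
    refine ae_restrict_of_forall_mem hBm fun w hw => ?_
    rw [Real.norm_of_nonneg (zhouMajorant_nonneg ρ (hρ.trans hw.1).le)]
    exact zhouMajorant_le_on hρ hw
  have hint : IntegrableOn (zhouMajorant ρ) (Ioi 0) := by
    rw [hAB]; exact hintA.union hintB
  refine ⟨hint, ?_⟩
  rw [hAB, setIntegral_union hdisj hBm hintA hintB]
  have eA : ∫ w in A, zhouMajorant ρ w ≤ Real.sqrt 3 * Real.Gamma η * ρ ^ (-η) := by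
    calc ∫ w in A, zhouMajorant ρ w ≤ ∫ w in A, g₁ w :=
          setIntegral_mono_on hintA (hg₁_int.mono_set sdiff_subset) hAm
            fun w hw => zhouMajorant_le_off hρ hη hη' hw.1 hw.2
      _ ≤ ∫ w in Ioi 0, g₁ w := by
          refine setIntegral_mono_set hg₁_int ?_ sdiff_subset.eventuallyLE
          refine ae_restrict_of_forall_mem measurableSet_Ioi fun w hw => ?_
          simp only [hg₁, Pi.zero_apply]
          have : (0 : ℝ) < w := hw
          positivity
      _ = _ := hg₁_val
  have eB : ∫ w in B, zhouMajorant ρ w ≤ 4 * Real.exp (-ρ) := by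
    calc ∫ w in B, zhouMajorant ρ w ≤ ∫ w in B, g₂ w :=
          setIntegral_mono_on hintB hg₂_int hBm fun w hw => zhouMajorant_le_on hρ hw
      _ = _ := hg₂_val
  linarith

/-- The majorant `m_ρ` is integrable on `(0, ∞)` for `ρ > 0`. [folklore] -/
theorem integrableOn_zhouMajorant {ρ : ℝ} (hρ : 0 < ρ) : IntegrableOn (zhouMajorant ρ) (Ioi 0) :=
  (integrableOn_zhouMajorant_and_integral_le hρ one_half_pos le_rfl).1

/-- The integrand of `P(z)` is integrable on `(0,∞)` for `z ≠ 0`. [folklore] -/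
theorem integrableOn_zhouIntegrand {z : ℂ} (hz : z ≠ 0) : IntegrableOn (zhouIntegrand z) (Ioi 0) :=
  Integrable.mono' (integrableOn_zhouMajorant (norm_pos_iff.2 hz))
    (measurable_zhouIntegrand z).aestronglyMeasurable.restrict (ae_norm_zhouIntegrand_le z)

/-- `‖P(z)‖ ≤ ∫₀^∞ m_{‖z‖}` (`z ≠ 0`). [folklore] -/
theorem norm_zhouP_le_integral {z : ℂ} (hz : z ≠ 0) :
    ‖zhouP z‖ ≤ ∫ w in Ioi 0, zhouMajorant ‖z‖ w :=
  norm_integral_le_of_norm_le (integrableOn_zhouMajorant (norm_pos_iff.2 hz))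
    (ae_norm_zhouIntegrand_le z)

/-- **The basic bound** `‖P(z)‖ ≤ √3 Γ(η) ‖z‖^{-η} + 4 e^{-‖z‖}` (`z ≠ 0`, `0 < η ≤ 1/2`). [folklore] -/
theorem norm_zhouP_le {z : ℂ} (hz : z ≠ 0) {η : ℝ} (hη : 0 < η) (hη' : η ≤ 1 / 2) :
    ‖zhouP z‖ ≤ Real.sqrt 3 * Real.Gamma η * ‖z‖ ^ (-η) + 4 * Real.exp (-‖z‖) :=
  (norm_zhouP_le_integral hz).trans
    (integrableOn_zhouMajorant_and_integral_le (norm_pos_iff.2 hz) hη hη').2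

/-- `e^{-ρ} ≤ ρ^{-1/2}` for `ρ > 0`. [folklore] -/
theorem exp_neg_le_rpow_neg_half {ρ : ℝ} (hρ : 0 < ρ) : Real.exp (-ρ) ≤ ρ ^ (-(1 / 2) : ℝ) := by
  rw [Real.exp_neg, Real.rpow_neg hρ.le, ← Real.sqrt_eq_rpow]
  refine inv_anti₀ (Real.sqrt_pos.2 hρ) ?_
  have h1 : Real.sqrt ρ ≤ ρ + 1 := by
    nlinarith [Real.sq_sqrt hρ.le, Real.sqrt_nonneg ρ, sq_nonneg (Real.sqrt ρ - 1 / 2)]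
  exact h1.trans (Real.add_one_le_exp ρ)

/-- **Decay**: `‖P(z)‖ ≤ (√3 √π + 4) ‖z‖^{-1/2}` for every `z ≠ 0`. [folklore] -/
theorem norm_zhouP_le_rpow_neg_half {z : ℂ} (hz : z ≠ 0) :
    ‖zhouP z‖ ≤ (Real.sqrt 3 * Real.sqrt Real.pi + 4) * ‖z‖ ^ (-(1 / 2) : ℝ) := by
  have h := norm_zhouP_le hz one_half_pos le_rfl
  rw [Real.Gamma_one_half_eq] at h
  have h2 := exp_neg_le_rpow_neg_half (norm_pos_iff.2 hz)
  nlinarith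

/-- **Logarithmic regime**: `‖P(z)‖ ≤ (√3 Γ(η) + 4) ‖z‖^{-η}` for `0 < ‖z‖ ≤ 1`, `0 < η ≤ 1/2`.
[folklore] -/
theorem norm_zhouP_le_rpow_neg {z : ℂ} (hz : z ≠ 0) (hz1 : ‖z‖ ≤ 1) {η : ℝ} (hη : 0 < η)
    (hη' : η ≤ 1 / 2) :
    ‖zhouP z‖ ≤ (Real.sqrt 3 * Real.Gamma η + 4) * ‖z‖ ^ (-η) := by
  have h := norm_zhouP_le hz hη hη'
  have hρ := norm_pos_iff.2 hz
  have h1 : Real.exp (-‖z‖) ≤ ‖z‖ ^ (-η) := by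
    calc Real.exp (-‖z‖) ≤ 1 := Real.exp_le_one_iff.2 (by linarith [norm_nonneg z])
      _ ≤ ‖z‖ ^ (-η) := Real.one_le_rpow_of_pos_of_le_one_of_nonpos hρ hz1 (by linarith)
  nlinarith [Real.Gamma_pos_of_pos hη]


end Literature.Analysis.FunctionSpaces
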